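import Summits.ValiantsHypothesis.ValiantsHypothesis.Theses.NewtonUnitEquations
import Summits.ValiantsHypothesis.ValiantsHypothesis.Theorems.HubHub
import Literature.Computability.AlgebraicComplexity.ValiantConjectureProofs

/-!
# ValiantsHypothesis / NewtonUnitEquations — assembly

Settles item stmt-ValiantsHypothesis-5910 (rank-1 assembly of route NewtonUnitEquations, shared
with the sibling route NewtonFrames):
`NewtonTauWeak → KpttTransfer → ValiantsHypothesis`.

Pure bookkeeping.  `KpttTransfer` (KPTT arXiv:1308.2286, Thm. 1, with the weak Newton-polygon
τ-conjecture `NewtonTauWeak` inlined verbatim as its hypothesis) applied to `NewtonTauWeak` gives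
`¬ IsVPFamily (fun n => perPoly (Fin n) ℂ)`; the hub lemma
`Summit.ValiantsHypothesis.Hub.valiantsHypothesis_of_not_isVPFamily_per` (Theorems/HubHub.lean)
then yields `ValiantsHypothesis` (`VP ℂ ≠ VNP ℂ`) from the two PROVED Literature facts it takes
as hypotheses: the renaming bridge
`Literature.Computability.AlgebraicComplexity.mem_VP_ofFintype_iff_holds`
(`perFamily ℂ ∈ VP ℂ ↔ IsVPFamily (fun n => perPoly (Fin n) ℂ)`; Bürgisser 2000, Rem. 2.2) and
Valiant's theorem `Literature.Computability.AlgebraicComplexity.perFamily_mem_VNP_holds ℂ`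
(`perFamily ℂ ∈ VNP ℂ`; Valiant 1979, Bürgisser 2000 Thm. 2.10).  No named-fact hypothesis remains:
the theorem is unconditional.
-/

namespace Summit.ValiantsHypothesis.Theorems.NewtonUnitEquations

/-- Settles stmt-ValiantsHypothesis-5910 (assembly of route NewtonUnitEquations):
`NewtonTauWeak → KpttTransfer → ValiantsHypothesis`.  Proof: `KpttTransfer NewtonTauWeak` is
`per ∉ VP_ℂ` (as `¬ IsVPFamily (fun n => perPoly (Fin n) ℂ)`); were `VP ℂ = VNP ℂ`, Valiant's
`perFamily ℂ ∈ VNP ℂ` (`perFamily_mem_VNP_holds`) and the renaming bridge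
(`mem_VP_ofFintype_iff_holds`) would make the permanent a `VP` family — the hub lemma
`valiantsHypothesis_of_not_isVPFamily_per` packages exactly this. [folklore] -/
theorem Assembly_proof :
    Summit.ValiantsHypothesis.ValiantsHypothesis.Theses.NewtonUnitEquations.Assembly := by
  unfold Summit.ValiantsHypothesis.ValiantsHypothesis.Theses.NewtonUnitEquations.Assembly
  intro hW hT
  exact Summit.ValiantsHypothesis.Hub.valiantsHypothesis_of_not_isVPFamily_per (hT hW)
    (Literature.Computability.AlgebraicComplexity.mem_VP_ofFintype_iff_holds _)
    (Literature.Computability.AlgebraicComplexity.perFamily_mem_VNP_holds ℂ)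

end Summit.ValiantsHypothesis.Theorems.NewtonUnitEquations
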